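import Literature.Algebra.GroupRings.CharpolyQuotientRankTwoModules
import Literature.Algebra.GroupRings.CharpolyQuotientRankTwoEquiv
import Literature.NumberTheory.GaloisRepresentations.ContinuousRep
import Mathlib.Tactic
import HarnessLib

/-!
# Boston–Lenstra–Ribet for framed (Galois) representations

Transcription of the Boston–Lenstra–Ribet theorem [BostonLenstraRibet1991, Thm. 1] — kernel
proofs in `Literature/Algebra/GroupRings/CharpolyQuotientRankTwo{,Modules}.lean` — into the
vocabulary used by the tree's Galois representations: a framed representation
`ρ : FramedRep G k 2 = G →ₜ* GL₂(k)` (e.g. an accepted `ModPGaloisRep K k 2`) over an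
algebraically closed field `k`, IRREDUCIBLE in the sense of `FramedRep.IsIrreducible`
(= Mathlib `Representation.IsIrreducible` of `g ↦ (v ↦ ρ(g) v)` on `Fin 2 → k`; over an
algebraically closed field this is absolute irreducibility), and a `k`-linear representation `σ`
of `G` on `M` on which every `g` is annihilated by the characteristic polynomial of `ρ(g)`:
`σ(g)² - tr ρ(g) σ(g) + det ρ(g) = 0`. This is exactly the shape in which [BLR] is applied to
`M = J(ℚ̄)[𝔪]` with `ρ = ρ_𝔪` (Mazur 1977 II.14, Ribet–Stein [RibetStein2008] §3.3, Wiese 2007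
Prop. 4.1, Buzzard 2000 Lemma 2.3 / Prop. 2.4, Darmon–Diamond–Taylor §4.5): the relation comes
from Eichler–Shimura at the unramified primes plus Chebotarev and continuity (NOT part of this
file). Conclusions: every `x ∈ k[G]` killed by `ρ` acts as `0` on `M`; `M` is a semisimple
`k[G]`-module, isotypic of type `ρ.toRepresentation`; `dim_k M = 2n`; and if `G` acts on `M`
through an abelian quotient then `M = 0`.

## References
* N. Boston, H. W. Lenstra, K. A. Ribet, C. R. Acad. Sci. Paris 312 (1991) 323–328
  [BostonLenstraRibet1991], Thm. 1.
* T. Y. Lam, A First Course in Noncommutative Rings [Lam2001FirstCourse], (7.3) (Burnside).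
-/

namespace Literature.NumberTheory.GaloisRepresentations

open MonoidAlgebra

universe u v w

section FramedBLR

variable {G : Type u} {k : Type v} [Group G] [TopologicalSpace G] [Field k] [TopologicalSpace k]

/-- The matrix-valued monoid hom `g ↦ (ρ g : M₂(k))` of a framed representation has standard
representation `(ofDistribMulAction k M₂(k) k²).comp _` EQUAL to `ρ.toRepresentation`
(both are `v ↦ ρ(g) v`). Private plumbing. [folklore] -/
private theorem std_comp_coeHom_eq_toRepresentation {n : ℕ} (ρ : FramedRep G k n) :
    (Representation.ofDistribMulAction k (Matrix (Fin n) (Fin n) k) (Fin n → k)).comp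
      ((Units.coeHom (Matrix (Fin n) (Fin n) k)).comp ρ.toMonoidHom) = ρ.toRepresentation := by
  refine MonoidHom.ext fun g => LinearMap.ext fun v => ?_
  rw [FramedRep.toRepresentation_apply_apply, MonoidHom.comp_apply,
    Representation.ofDistribMulAction_apply_apply, Matrix.smul_eq_mulVec]
  rfl

/-- **Burnside for framed representations.** Over an algebraically closed field, an irreducible
framed representation `ρ : G →ₜ* GLₙ(k)` (`n ≥ 1`) has `k`-linearly spanning image:
`MonoidAlgebra.lift (g ↦ (ρ g : Mₙ(k))) : k[G] → Mₙ(k)` is onto — the surjectivity hypothesis of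
the Boston–Lenstra–Ribet theorem. [cite: Lam2001FirstCourse, (7.3) and the remark following it (Burnside's theorem)] -/
theorem FramedRep.lift_coe_surjective_of_isIrreducible [IsAlgClosed k] {n : ℕ} [NeZero n]
    (ρ : FramedRep G k n) (hirr : ρ.IsIrreducible) :
    Function.Surjective (MonoidAlgebra.lift k (Matrix (Fin n) (Fin n) k) G
      ((Units.coeHom (Matrix (Fin n) (Fin n) k)).comp ρ.toMonoidHom)) := by
  haveI : Nonempty (Fin n) := ⟨⟨0, Nat.pos_of_ne_zero (NeZero.ne n)⟩⟩
  refine Literature.Algebra.GroupRings.lift_surjective_of_isIrreducible _ ?_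
  rw [std_comp_coeHom_eq_toRepresentation]
  exact hirr

variable [IsAlgClosed k] {M : Type w} [AddCommGroup M] [Module k M]

/-- **Boston–Lenstra–Ribet for an irreducible framed representation, kernel form**: if
`ρ : G →ₜ* GL₂(k)` is irreducible (`k` algebraically closed) and `σ(g)² - tr ρ(g) σ(g) + det ρ(g) = 0`
on `M` for all `g`, then every element of `k[G]` killed by `ρ` acts as `0` on `M`.
[cite: BostonLenstraRibet1991, Thm. 1] -/
theorem FramedRep.asAlgebraHom_apply_eq_zero_of_charpolyRel (ρ : FramedRep G k 2)
    (hirr : ρ.IsIrreducible) (σ : Representation k G M)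
    (hσ : ∀ g : G, σ g * σ g - ((ρ g : GL (Fin 2) k) : Matrix (Fin 2) (Fin 2) k).trace • σ g
      + ((ρ g : GL (Fin 2) k) : Matrix (Fin 2) (Fin 2) k).det • (1 : Module.End k M) = 0)
    {x : MonoidAlgebra k G}
    (hx : MonoidAlgebra.lift k (Matrix (Fin 2) (Fin 2) k) G
      ((Units.coeHom (Matrix (Fin 2) (Fin 2) k)).comp ρ.toMonoidHom) x = 0) :
    σ.asAlgebraHom x = 0 :=
  Literature.Algebra.GroupRings.asAlgebraHom_apply_eq_zero_of_charpolyRel _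
    (ρ.lift_coe_surjective_of_isIrreducible hirr) σ (fun g => by simpa using hσ g) hx

/-- **Boston–Lenstra–Ribet for an irreducible framed representation: semisimplicity.**
[cite: BostonLenstraRibet1991, Thm. 1] -/
theorem FramedRep.isSemisimpleModule_of_charpolyRel (ρ : FramedRep G k 2)
    (hirr : ρ.IsIrreducible) (σ : Representation k G M)
    (hσ : ∀ g : G, σ g * σ g - ((ρ g : GL (Fin 2) k) : Matrix (Fin 2) (Fin 2) k).trace • σ g
      + ((ρ g : GL (Fin 2) k) : Matrix (Fin 2) (Fin 2) k).det • (1 : Module.End k M) = 0) :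
    IsSemisimpleModule (MonoidAlgebra k G) σ.asModule :=
  Literature.Algebra.GroupRings.isSemisimpleModule_of_charpolyRel _
    (ρ.lift_coe_surjective_of_isIrreducible hirr) σ (fun g => by simpa using hσ g)

/-- **Boston–Lenstra–Ribet for an irreducible framed representation: `M` is isotypic of type `ρ`**
— every simple `k[G]`-submodule of `M` is isomorphic to `ρ.toRepresentation.asModule`
("`J[𝔪] ≈ ⨁ V_𝔪`", Ribet–Stein §3.3). [cite: BostonLenstraRibet1991, Thm. 1] -/
theorem FramedRep.isIsotypicOfType_of_charpolyRel (ρ : FramedRep G k 2)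
    (hirr : ρ.IsIrreducible) (σ : Representation k G M)
    (hσ : ∀ g : G, σ g * σ g - ((ρ g : GL (Fin 2) k) : Matrix (Fin 2) (Fin 2) k).trace • σ g
      + ((ρ g : GL (Fin 2) k) : Matrix (Fin 2) (Fin 2) k).det • (1 : Module.End k M) = 0) :
    IsIsotypicOfType (MonoidAlgebra k G) σ.asModule ρ.toRepresentation.asModule := by
  rw [← std_comp_coeHom_eq_toRepresentation]
  exact Literature.Algebra.GroupRings.isIsotypicOfType_of_charpolyRel _
    (ρ.lift_coe_surjective_of_isIrreducible hirr) σ (fun g => by simpa using hσ g)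

/-- **Boston–Lenstra–Ribet for an irreducible framed representation: `M ≅ ⨁ ρ`.**
[cite: BostonLenstraRibet1991, Thm. 1] -/
theorem FramedRep.exists_linearEquiv_finsupp_of_charpolyRel {M : Type w} [AddCommGroup M]
    [Module k M] (ρ : FramedRep G k 2)
    (hirr : ρ.IsIrreducible) (σ : Representation k G M)
    (hσ : ∀ g : G, σ g * σ g - ((ρ g : GL (Fin 2) k) : Matrix (Fin 2) (Fin 2) k).trace • σ g
      + ((ρ g : GL (Fin 2) k) : Matrix (Fin 2) (Fin 2) k).det • (1 : Module.End k M) = 0) :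
    ∃ ι : Type w, Nonempty (σ.asModule ≃ₗ[MonoidAlgebra k G] (ι →₀ ρ.toRepresentation.asModule)) := by
  haveI := ρ.isSemisimpleModule_of_charpolyRel hirr σ hσ
  exact (ρ.isIsotypicOfType_of_charpolyRel hirr σ hσ).linearEquiv_finsupp

/-- **Multiplicity**: under [BLR, Thm. 1] for an irreducible framed `ρ : G →ₜ* GL₂(k)`, a
finite-dimensional `M` is `≅ ρ^n` with `dim_k M = 2n`. [cite: BostonLenstraRibet1991, Thm. 1] -/
theorem FramedRep.exists_finrank_eq_two_mul_of_charpolyRel [Module.Finite k M] (ρ : FramedRep G k 2)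
    (hirr : ρ.IsIrreducible) (σ : Representation k G M)
    (hσ : ∀ g : G, σ g * σ g - ((ρ g : GL (Fin 2) k) : Matrix (Fin 2) (Fin 2) k).trace • σ g
      + ((ρ g : GL (Fin 2) k) : Matrix (Fin 2) (Fin 2) k).det • (1 : Module.End k M) = 0) :
    ∃ n : ℕ, Nonempty (σ.asModule ≃ₗ[MonoidAlgebra k G] (Fin n → ρ.toRepresentation.asModule)) ∧
      Module.finrank k M = 2 * n := by
  haveI := ρ.isSemisimpleModule_of_charpolyRel hirr σ hσ
  haveI : Module.Finite (MonoidAlgebra k G) σ.asModule :=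
    Module.Finite.of_restrictScalars_finite k (MonoidAlgebra k G) σ.asModule
  obtain ⟨n, ⟨e⟩⟩ := (ρ.isIsotypicOfType_of_charpolyRel hirr σ hσ).linearEquiv_fun
  refine ⟨n, ⟨e⟩, ?_⟩
  have hV2 : Module.finrank k ρ.toRepresentation.asModule = 2 := by
    rw [ρ.toRepresentation.asModuleEquiv.finrank_eq, Module.finrank_fin_fun]
  calc Module.finrank k M = Module.finrank k σ.asModule := σ.asModuleEquiv.finrank_eq.symm
    _ = Module.finrank k (Fin n → ρ.toRepresentation.asModule) := (e.restrictScalars k).finrank_eq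
    _ = 2 * n := by
      rw [Module.finrank_pi_fintype, Finset.sum_const, Finset.card_univ, Fintype.card_fin, hV2,
        smul_eq_mul, mul_comm]

/-- **No abelian action** (Buzzard 2000 Lemma 2.3's use of [BLR]): under [BLR, Thm. 1] for an
irreducible framed `ρ : G →ₜ* GL₂(k)`, if the `σ(g)` pairwise commute (`G` acts on `M` through an
abelian quotient) then `M = 0`. [cite: BostonLenstraRibet1991, Thm. 1] -/
theorem FramedRep.subsingleton_of_charpolyRel_of_commute (ρ : FramedRep G k 2)
    (hirr : ρ.IsIrreducible) (σ : Representation k G M)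
    (hσ : ∀ g : G, σ g * σ g - ((ρ g : GL (Fin 2) k) : Matrix (Fin 2) (Fin 2) k).trace • σ g
      + ((ρ g : GL (Fin 2) k) : Matrix (Fin 2) (Fin 2) k).det • (1 : Module.End k M) = 0)
    (hcomm : ∀ g h : G, Commute (σ g) (σ h)) : Subsingleton M :=
  Literature.Algebra.GroupRings.subsingleton_of_charpolyRel_of_commute _
    (ρ.lift_coe_surjective_of_isIrreducible hirr) σ (fun g => by simpa using hσ g) hcomm

end FramedBLR

section FramedBLREquiv

variable {G : Type u} {k : Type v} [Group G] [TopologicalSpace G] [Field k] [TopologicalSpace k]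
  [IsAlgClosed k] {M : Type w} [AddCommGroup M] [Module k M]

/-- **Boston–Lenstra–Ribet for an irreducible framed representation, equivariant form: `σ ≃ ρ^{(ι)}`.**
If `ρ : G →ₜ* GL₂(k)` is irreducible (`k` algebraically closed) and
`σ(g)² - tr ρ(g) σ(g) + det ρ(g) = 0` on `M` for all `g`, then `σ` is isomorphic AS A REPRESENTATION
(`Representation.Equiv`: a `G`-equivariant `k`-linear isomorphism) to a direct sum of copies of
`ρ.toRepresentation`. [cite: BostonLenstraRibet1991, Thm. 1] -/
theorem FramedRep.exists_representationEquiv_finsupp_of_charpolyRel (ρ : FramedRep G k 2)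
    (hirr : ρ.IsIrreducible) (σ : Representation k G M)
    (hσ : ∀ g : G, σ g * σ g - ((ρ g : GL (Fin 2) k) : Matrix (Fin 2) (Fin 2) k).trace • σ g
      + ((ρ g : GL (Fin 2) k) : Matrix (Fin 2) (Fin 2) k).det • (1 : Module.End k M) = 0) :
    ∃ ι : Type w, Nonempty (σ.Equiv (ρ.toRepresentation.finsupp ι)) := by
  rw [← std_comp_coeHom_eq_toRepresentation]
  exact Literature.Algebra.GroupRings.exists_representationEquiv_finsupp_of_charpolyRel _
    (ρ.lift_coe_surjective_of_isIrreducible hirr) σ (fun g => by simpa using hσ g)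

end FramedBLREquiv

end Literature.NumberTheory.GaloisRepresentations
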